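import Summits.Schanuel.Schanuel.Theorems.ZilberEacDensityRealSlopeLemmas
import HarnessLib

/-!
# Real-slope line surfaces II: the exponential polynomial `Φ_u` and the level curve

HONEST FRAMING.  Part of a three-file proof of modest rungs of the case ladder of ZILBER'S
EXPONENTIAL-ALGEBRAIC CLOSEDNESS conjecture (EAC): the Mantova–Masser "unprojected density" question
for the line surfaces `{x₁ = a x₀ + b, y₀ = q(y₁)}` of REAL irrational slope (main theorems in
`ZilberEacDensityRealSlope`).  It is NOT Schanuel's conjecture, does not use it, and EAC does not
imply Schanuel's conjecture; `EC(3,2)` and the density question in general remain OPEN.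

Contents:

* Part D — `Φ_u(ζ) = e^{ζ} - q(u e^{aζ+b})` (`lineFn`) is entire and, for `u ≠ 0` and `a ∉ ℚ`,
  not identically zero (`exists_lineFn_ne_zero`: else `q(e^{2πi a} w) ≡ q(w)` would make `q`, hence
  `e^{ζ}`, constant); the scalar twist `twist q c` of a polynomial.
* Part E — THE NEW INPUT FOR THE FIBRE COORDINATE: for `a ∈ ℝ \ ℚ` and `q(0) ≠ 0` the level curve
  `L = {w ≠ 0 : q(w) ≠ 0, log|w| = a log|q(w)| + Re b}` is INFINITE (`levelSet_infinite`):
  `ψ = log|w| - a log|q(w)| - Re b` is continuous off the finite set `{0} ∪ q⁻¹(0)`, tends to `-∞`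
  at `0` and to `+∞` at `∞` (if `1 - a·deg q > 0`) or at a non-zero root of `q` (if `< 0`; the sign
  is decided since `a ∉ ℚ`), and the complement of a finite subset of `ℂ` is connected, so a finite
  `L` would contradict the intermediate value theorem.
-/

noncomputable section

open Filter Topology Metric Set Complex Polynomial Bornology
open Literature.NumberTheory.Transcendental Literature.ModelTheory.Zilber
open Literature.ModelTheory.ExponentialFields

set_option linter.dupNamespace false

namespace Summit.Schanuel.Schanuel.Theorems

/-! ## Part D. The exponential polynomial `Φ_u(ζ) = e^ζ - q(u e^{aζ+b})` is entire and not
identically zero -/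

section LineFn

/-- `Φ_u(ζ) = e^{ζ} - q(u · e^{a ζ + b})`: for `|u| = 1`, `u = e^{2πi n a}`, its zeros `ζ` are the
exponential points `z = ζ + 2πi n` of the line surface read in the window `z - 2πi n`. (new) -/
def lineFn (a : ℝ) (b : ℂ) (q : Polynomial ℂ) (u ζ : ℂ) : ℂ :=
  exp ζ - q.eval (u * exp ((a : ℂ) * ζ + b))

/-- `Φ_u` is entire. -/
theorem differentiable_lineFn (a : ℝ) (b : ℂ) (q : Polynomial ℂ) (u : ℂ) :
    Differentiable ℂ (lineFn a b q u) := by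
  have h1 : Differentiable ℂ fun ζ : ℂ => u * exp ((a : ℂ) * ζ + b) :=
    (Complex.differentiable_exp.comp
      (((differentiable_const _).mul differentiable_id).add (differentiable_const _))).const_mul u
  have h2 : Differentiable ℂ fun ζ : ℂ => q.eval (u * exp ((a : ℂ) * ζ + b)) :=
    q.differentiable.comp h1
  exact Complex.differentiable_exp.sub h2

/-- The fibre polynomial twisted by a scalar: `(twist q c)(w) = q(c w)`. (new) -/
def twist (q : Polynomial ℂ) (c : ℂ) : Polynomial ℂ :=
  ∑ j ∈ Finset.range (q.natDegree + 1), Polynomial.C (q.coeff j * c ^ j) * Polynomial.X ^ j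

/-- `(twist q c)(w) = q(c w)`. -/
theorem eval_twist (q : Polynomial ℂ) (c w : ℂ) : (twist q c).eval w = q.eval (c * w) := by
  rw [twist, Polynomial.eval_finsetSum, Polynomial.eval_eq_sum_range]
  refine Finset.sum_congr rfl fun j _ => ?_
  simp only [Polynomial.eval_mul, Polynomial.eval_C, Polynomial.eval_pow, Polynomial.eval_X]
  rw [mul_pow]
  ring

/-- Coefficients of the twist: `coeff_j (twist q c) = coeff_j(q) · c^j`. -/
theorem coeff_twist (q : Polynomial ℂ) (c : ℂ) (j : ℕ) :
    (twist q c).coeff j = q.coeff j * c ^ j := by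
  rw [twist, Polynomial.finsetSum_coeff]
  simp only [Polynomial.coeff_C_mul, Polynomial.coeff_X_pow]
  rw [Finset.sum_eq_single j]
  · simp
  · intro i _ hij
    simp [Ne.symm hij]
  · intro hj
    rw [Finset.mem_range, not_lt] at hj
    simp [Polynomial.coeff_eq_zero_of_natDegree_lt (by omega : q.natDegree < j)]

/-- If `q(c w) = q(w)` for all `w ≠ 0` and no positive power of `c` is `1`, then `q` is constant. -/
theorem eq_C_of_eval_mul_eq (q : Polynomial ℂ) {c : ℂ} (hc : ∀ j : ℕ, 0 < j → c ^ j ≠ 1)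
    (h : ∀ w : ℂ, w ≠ 0 → q.eval (c * w) = q.eval w) : q = Polynomial.C (q.coeff 0) := by
  have htw : twist q c = q := by
    refine Polynomial.eq_of_infinite_eval_eq _ _ ((Set.finite_singleton (0 : ℂ)).infinite_compl.mono ?_)
    intro w hw
    exact (eval_twist q c w).trans (h w hw)
  ext j
  rcases j with _ | j
  · simp
  · rw [Polynomial.coeff_C, if_neg (Nat.succ_ne_zero j)]
    have hj : q.coeff (j + 1) * c ^ (j + 1) = q.coeff (j + 1) := by
      have := congrArg (fun p : Polynomial ℂ => p.coeff (j + 1)) htw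
      simpa only [coeff_twist] using this
    have h0 : q.coeff (j + 1) * (c ^ (j + 1) - 1) = 0 := by
      rw [mul_sub, mul_one, sub_eq_zero]; exact hj
    rcases mul_eq_zero.1 h0 with h1 | h1
    · exact h1
    · exact absurd (sub_eq_zero.1 h1) (hc (j + 1) (Nat.succ_pos j))

/-- `urot a ^ j ≠ 1` for `j ≥ 1` and irrational `a` (`e^{2πi j a} = 1` would make `j a ∈ ℤ`). -/
theorem urot_pow_ne_one {a : ℝ} (ha : Irrational a) {j : ℕ} (hj : 0 < j) : urot a ^ j ≠ 1 := by
  intro h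
  rw [urot, ← Complex.exp_nat_mul, Complex.exp_eq_one_iff] at h
  obtain ⟨n, hn⟩ := h
  have h2 : (2 * Real.pi * I : ℂ) ≠ 0 := by simp [Real.pi_ne_zero, Complex.I_ne_zero]
  have hja : (j : ℂ) * (a : ℂ) = n := by
    apply mul_right_cancel₀ h2
    rw [← hn]; ring
  have hre : (j : ℝ) * a = n := by
    have := congrArg Complex.re hja
    simpa using this
  have hj' : (j : ℝ) ≠ 0 := by exact_mod_cast hj.ne'
  exact (irrational_iff_ne_rational a).1 ha n j (by exact_mod_cast hj.ne')
    (by rw [Int.cast_natCast, eq_div_iff hj', mul_comm]; exact hre)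

/-- **`Φ_u ≢ 0`** (`u ≠ 0`, `a ∉ ℚ`): if `e^ζ ≡ q(u e^{aζ+b})` then, comparing `ζ` with
`ζ + 2πi`, `q(e^{2πi a} w) ≡ q(w)`, so `q` is constant (`e^{2πi a}` is not a root of unity) and
`e^ζ` would be constant. -/
theorem exists_lineFn_ne_zero {a : ℝ} (ha : Irrational a) (b : ℂ) (q : Polynomial ℂ) {u : ℂ}
    (hu : u ≠ 0) : ∃ ζ, lineFn a b q u ζ ≠ 0 := by
  by_contra h
  push Not at h
  have ha0 : (a : ℂ) ≠ 0 := Complex.ofReal_ne_zero.2 ha.ne_zero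
  have hper : ∀ w : ℂ, w ≠ 0 → q.eval (urot a * w) = q.eval w := by
    intro w hw
    obtain ⟨ζ, hζ⟩ : ∃ ζ : ℂ, u * exp ((a : ℂ) * ζ + b) = w := by
      refine ⟨(a : ℂ)⁻¹ * (Complex.log (w / u) - b), ?_⟩
      rw [mul_inv_cancel_left₀ ha0, sub_add_cancel, Complex.exp_log (div_ne_zero hw hu),
        ← mul_div_assoc, mul_div_cancel_left₀ w hu]
    have key : ∀ ζ' : ℂ, exp ζ' = q.eval (u * exp ((a : ℂ) * ζ' + b)) := fun ζ' =>
      sub_eq_zero.1 (h ζ')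
    have h1 := key ζ
    have h2 := key (ζ + 2 * Real.pi * I)
    have e2 : u * exp ((a : ℂ) * (ζ + 2 * Real.pi * I) + b) = urot a * w := by
      rw [← hζ]
      have e3 : (a : ℂ) * (ζ + 2 * Real.pi * I) + b =
          ((a : ℂ) * ζ + b) + (a : ℂ) * (2 * Real.pi * I) := by ring
      rw [e3, Complex.exp_add ((a : ℂ) * ζ + b)]
      simp only [urot]
      ring
    have e1 : exp (ζ + 2 * Real.pi * I) = exp ζ := by
      rw [Complex.exp_add, Complex.exp_two_pi_mul_I, mul_one]
    rw [e2, e1, h1, hζ] at h2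
    exact h2.symm
  have hq := eq_C_of_eval_mul_eq q (fun j hj => urot_pow_ne_one ha hj) hper
  have h0 := h 0
  have hπ := h (Real.pi * I)
  rw [lineFn, hq, Polynomial.eval_C, Complex.exp_zero, sub_eq_zero] at h0
  rw [lineFn, hq, Polynomial.eval_C, Complex.exp_pi_mul_I, sub_eq_zero] at hπ
  have : (1 : ℂ) = -1 := h0.trans hπ.symm
  norm_num at this

end LineFn

/-! ## Part E. The level curve `|w| = e^{Re b} |q(w)|^{a}` is infinite -/

section LevelSet

variable (a : ℝ) (b : ℂ) (q : Polynomial ℂ)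

/-- `ψ(w) = log|w| - a log|q(w)| - Re b`; off `{0} ∪ q⁻¹(0)` its zero set is the level curve
`L = {|w| = e^{Re b} |q(w)|^a}` on which the limits of the fibre coordinate live. (new) -/
def psi (w : ℂ) : ℝ := Real.log ‖w‖ - a * Real.log ‖q.eval w‖ - b.re

/-- `ψ` is continuous off `{0} ∪ q⁻¹(0)`. -/
theorem continuousOn_psi {E : Set ℂ} (hE : ∀ w ∈ E, w ≠ 0 ∧ q.eval w ≠ 0) :
    ContinuousOn (psi a b q) E := by
  have h1 : ContinuousOn (fun w : ℂ => Real.log ‖w‖) E :=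
    continuous_norm.continuousOn.log fun w hw => norm_ne_zero_iff.2 (hE w hw).1
  have h2 : ContinuousOn (fun w : ℂ => Real.log ‖q.eval w‖) E :=
    (q.continuous.norm).continuousOn.log fun w hw => norm_ne_zero_iff.2 (hE w hw).2
  exact (h1.sub (continuousOn_const.mul h2)).sub continuousOn_const

/-- A punctured neighbourhood eventually avoids any finite set. -/
theorem eventually_nhdsNE_not_mem {F : Set ℂ} (hF : F.Finite) (c : ℂ) :
    ∀ᶠ w in 𝓝[≠] c, w ∉ F := by
  have h1 : (F \ {c})ᶜ ∈ 𝓝 c := (hF.sdiff).isClosed.compl_mem_nhds (by simp)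
  have h2 : ∀ᶠ w in 𝓝[≠] c, w ≠ c := self_mem_nhdsWithin
  filter_upwards [mem_nhdsWithin_of_mem_nhds h1, h2] with w hw1 hw2
  intro hwF
  exact hw1 ⟨hwF, by simpa using hw2⟩

/-- The cobounded filter eventually avoids any finite set. -/
theorem eventually_cobounded_not_mem {F : Set ℂ} (hF : F.Finite) : ∀ᶠ w in cobounded ℂ, w ∉ F :=
  isBounded_def.1 hF.isBounded

/-- A non-zero polynomial is eventually non-zero on punctured neighbourhoods. -/
theorem eventually_nhdsNE_eval_ne_zero {q : Polynomial ℂ} (hq : q ≠ 0) (c : ℂ) :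
    ∀ᶠ w in 𝓝[≠] c, q.eval w ≠ 0 := by
  filter_upwards [eventually_nhdsNE_not_mem q.roots.toFinset.finite_toSet c] with w hw
  intro h0
  exact hw (by simpa [Polynomial.mem_roots hq] using h0)

/-- **Source at `0`**: if `q(0) ≠ 0` then `ψ → -∞` as `w → 0`. -/
theorem tendsto_psi_nhdsNE_zero (hq0 : q.eval 0 ≠ 0) : Tendsto (psi a b q) (𝓝[≠] 0) atBot := by
  have h1 : Tendsto (fun w : ℂ => Real.log ‖w‖) (𝓝[≠] 0) atBot :=
    Real.tendsto_log_nhdsGT_zero.comp tendsto_norm_nhdsNE_zero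
  have h2 : Tendsto (fun w : ℂ => -(a * Real.log ‖q.eval w‖) - b.re) (𝓝[≠] 0)
      (𝓝 (-(a * Real.log ‖q.eval 0‖) - b.re)) := by
    have hc : ContinuousAt (fun w : ℂ => -(a * Real.log ‖q.eval w‖) - b.re) 0 := by
      have : ContinuousAt (fun w : ℂ => Real.log ‖q.eval w‖) 0 :=
        (q.continuous.norm.continuousAt).log (norm_ne_zero_iff.2 hq0)
      exact (this.const_mul a).neg.sub continuousAt_const
    exact hc.tendsto.mono_left nhdsWithin_le_nhds
  refine (h1.atBot_add h2).congr fun w => ?_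
  simp only [psi]; ring

/-- `q(w) = q̃(w⁻¹) · w^{deg q}` with `q̃` the reverse polynomial (`w ≠ 0`). -/
theorem eval_eq_reverse_mul_pow {w : ℂ} (hw : w ≠ 0) :
    q.eval w = q.reverse.eval w⁻¹ * w ^ q.natDegree := by
  haveI := invertibleOfNonzero hw
  have h := Polynomial.eval₂_reverse_mul_pow (RingHom.id ℂ) w q
  rw [invOf_eq_inv, Polynomial.eval₂_id, Polynomial.eval₂_id] at h
  exact h.symm

/-- **Source at `∞`**: if `1 - a · deg q > 0` then `ψ → +∞` as `w → ∞`
(`log|q(w)| = deg q · log|w| + O(1)`). -/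
theorem tendsto_psi_cobounded_atTop (hq : q ≠ 0) (h : 0 < 1 - a * q.natDegree) :
    Tendsto (psi a b q) (cobounded ℂ) atTop := by
  have hlc : q.reverse.eval 0 ≠ 0 := by
    rw [← Polynomial.coeff_zero_eq_eval_zero, Polynomial.coeff_zero_reverse]
    exact Polynomial.leadingCoeff_ne_zero.2 hq
  have hrev : Tendsto (fun w : ℂ => q.reverse.eval w⁻¹) (cobounded ℂ) (𝓝 (q.reverse.eval 0)) :=
    (q.reverse.continuous.tendsto 0).comp tendsto_inv₀_cobounded
  have hg : Tendsto (fun w : ℂ => -(a * Real.log ‖q.reverse.eval w⁻¹‖) - b.re) (cobounded ℂ)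
      (𝓝 (-(a * Real.log ‖q.reverse.eval 0‖) - b.re)) :=
    ((hrev.norm.log (norm_ne_zero_iff.2 hlc)).const_mul a).neg.sub tendsto_const_nhds
  have hf : Tendsto (fun w : ℂ => (1 - a * q.natDegree) * Real.log ‖w‖) (cobounded ℂ) atTop :=
    (Real.tendsto_log_atTop.comp tendsto_norm_cobounded_atTop).const_mul_atTop h
  refine (hf.atTop_add hg).congr' ?_
  filter_upwards [eventually_cobounded_not_mem (Set.finite_singleton (0 : ℂ)),
    hrev.eventually (eventually_ne_nhds hlc)] with w hw0 hrw
  rw [Set.mem_singleton_iff] at hw0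
  have hlog : Real.log ‖q.eval w‖ = Real.log ‖q.reverse.eval w⁻¹‖ + q.natDegree * Real.log ‖w‖ := by
    rw [eval_eq_reverse_mul_pow q hw0, norm_mul, norm_pow,
      Real.log_mul (norm_ne_zero_iff.2 hrw) (pow_ne_zero _ (norm_ne_zero_iff.2 hw0)), Real.log_pow]
  simp only [psi, hlog]
  ring

/-- **Source at a non-zero root**: if `a > 0` and `q(ρ) = 0`, `ρ ≠ 0`, then `ψ → +∞` as `w → ρ`. -/
theorem tendsto_psi_nhdsNE_root (hq : q ≠ 0) (ha : 0 < a) {ρ : ℂ} (hρ : ρ ≠ 0)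
    (hqρ : q.eval ρ = 0) : Tendsto (psi a b q) (𝓝[≠] ρ) atTop := by
  have h1 : Tendsto (fun w => ‖q.eval w‖) (𝓝[≠] ρ) (𝓝[>] 0) := by
    rw [tendsto_nhdsWithin_iff]
    constructor
    · have : Tendsto (fun w => ‖q.eval w‖) (𝓝 ρ) (𝓝 0) := by
        simpa [hqρ] using (q.continuous.norm).tendsto ρ
      exact this.mono_left nhdsWithin_le_nhds
    · filter_upwards [eventually_nhdsNE_eval_ne_zero hq ρ] with w hw
      exact norm_pos_iff.2 hw
  have h2 : Tendsto (fun w => Real.log ‖q.eval w‖) (𝓝[≠] ρ) atBot :=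
    Real.tendsto_log_nhdsGT_zero.comp h1
  have h3 : Tendsto (fun w => -a * Real.log ‖q.eval w‖) (𝓝[≠] ρ) atTop :=
    h2.const_mul_atBot_of_neg (neg_lt_zero.2 ha)
  have h4 : Tendsto (fun w : ℂ => Real.log ‖w‖ - b.re) (𝓝[≠] ρ) (𝓝 (Real.log ‖ρ‖ - b.re)) := by
    have hc : ContinuousAt (fun w : ℂ => Real.log ‖w‖ - b.re) ρ :=
      ((continuous_norm.continuousAt).log (norm_ne_zero_iff.2 hρ)).sub continuousAt_const
    exact hc.tendsto.mono_left nhdsWithin_le_nhds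
  refine (h3.atTop_add h4).congr fun w => ?_
  simp only [psi]; ring

variable {a b q}

/-- Extraction: a filter along which `ψ → +∞` yields points of positive `ψ` outside any eventually
avoided set. -/
theorem exists_psi_pos {ℓ : Filter ℂ} [ℓ.NeBot] (h : Tendsto (psi a b q) ℓ atTop) {E : Set ℂ}
    (hE : ∀ᶠ w in ℓ, w ∉ E) : ∃ w, w ∉ E ∧ 0 < psi a b q w :=
  (hE.and (h.eventually (eventually_gt_atTop 0))).exists

/-- Extraction, negative side. -/
theorem exists_psi_neg {ℓ : Filter ℂ} [ℓ.NeBot] (h : Tendsto (psi a b q) ℓ atBot) {E : Set ℂ}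
    (hE : ∀ᶠ w in ℓ, w ∉ E) : ∃ w, w ∉ E ∧ psi a b q w < 0 :=
  (hE.and (h.eventually (eventually_lt_atBot 0))).exists

/-- `1 - a · d ≠ 0` for irrational `a` and `d ∈ ℕ`. -/
theorem one_sub_mul_natCast_ne_zero {a : ℝ} (ha : Irrational a) (d : ℕ) : (1 : ℝ) - a * d ≠ 0 := by
  intro h0
  have hd : (d : ℝ) ≠ 0 := by
    intro hd; rw [hd, mul_zero, sub_zero] at h0; exact one_ne_zero h0
  exact (irrational_iff_ne_rational a).1 ha 1 d (by exact_mod_cast hd)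
    (by rw [Int.cast_one, Int.cast_natCast, eq_div_iff hd]; linarith)

/-- **The level curve is infinite.** For `a ∉ ℚ` real and `q(0) ≠ 0`, the set
`L = {w ≠ 0 : q(w) ≠ 0, log|w| = a log|q(w)| + Re b}` is infinite.  Proof: `ψ` is continuous on
the complement of the finite set `{0} ∪ q⁻¹(0)`, tends to `-∞` at `0` and to `+∞` at `∞` (if
`1 - a deg q > 0`) or at a root of `q` (if `1 - a deg q < 0`, so `a > 0`); were `L` finite, `ψ`
would be continuous and zero-free on the CONNECTED complement of a finite subset of `ℂ` while
taking both signs — contradicting the intermediate value theorem. (new) -/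
theorem levelSet_infinite {a : ℝ} (ha : Irrational a) (b : ℂ) {q : Polynomial ℂ}
    (hq0 : q.eval 0 ≠ 0) : {w : ℂ | w ≠ 0 ∧ q.eval w ≠ 0 ∧ psi a b q w = 0}.Infinite := by
  intro hfin
  have hq : q ≠ 0 := fun h => hq0 (by rw [h, Polynomial.eval_zero])
  set L := {w : ℂ | w ≠ 0 ∧ q.eval w ≠ 0 ∧ psi a b q w = 0} with hL
  set Bad : Set ℂ := insert 0 (q.roots.toFinset : Set ℂ) with hBad
  have hBadfin : Bad.Finite := q.roots.toFinset.finite_toSet.insert 0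
  have hBad_iff : ∀ w, w ∉ Bad ↔ (w ≠ 0 ∧ q.eval w ≠ 0) := by
    intro w
    simp only [hBad, Set.mem_insert_iff, Finset.mem_coe, Multiset.mem_toFinset,
      Polynomial.mem_roots hq, Polynomial.IsRoot.def, not_or]
  set E : Set ℂ := Bad ∪ L with hE
  have hEfin : E.Finite := hBadfin.union hfin
  have hconn : IsPreconnected Eᶜ :=
    (hEfin.countable.isPathConnected_compl_of_one_lt_rank
      (Complex.rank_real_complex ▸ Nat.one_lt_ofNat)).isConnected.isPreconnected
  have hEgood : ∀ w ∈ Eᶜ, w ≠ 0 ∧ q.eval w ≠ 0 := fun w hw => (hBad_iff w).1 fun h' => hw (Or.inl h')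
  have hcont : ContinuousOn (psi a b q) Eᶜ := continuousOn_psi a b q hEgood
  obtain ⟨wn, hwnE, hneg⟩ :=
    exists_psi_neg (tendsto_psi_nhdsNE_zero a b q hq0) (eventually_nhdsNE_not_mem hEfin 0)
  have hne : (1 : ℝ) - a * q.natDegree ≠ 0 := one_sub_mul_natCast_ne_zero ha _
  obtain ⟨wp, hwpE, hpos⟩ : ∃ w, w ∉ E ∧ 0 < psi a b q w := by
    rcases hne.lt_or_gt with hlt | hgt
    · have hapos : 0 < a := by
        by_contra hle
        push Not at hle
        have : a * q.natDegree ≤ 0 :=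
          mul_nonpos_of_nonpos_of_nonneg hle (Nat.cast_nonneg _)
        linarith
      have hd : 0 < q.natDegree := by
        by_contra h0
        push Not at h0
        rw [Nat.le_zero.1 h0, Nat.cast_zero, mul_zero, sub_zero] at hlt
        exact absurd hlt (not_lt.2 zero_le_one)
      have hdeg : 0 < q.degree := by
        rw [Polynomial.degree_eq_natDegree hq]; exact_mod_cast hd
      obtain ⟨ρ, hρ⟩ := Complex.exists_root hdeg
      have hρ0 : ρ ≠ 0 := by rintro rfl; exact hq0 hρ
      exact exists_psi_pos (tendsto_psi_nhdsNE_root a b q hq hapos hρ0 hρ)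
        (eventually_nhdsNE_not_mem hEfin ρ)
    · exact exists_psi_pos (tendsto_psi_cobounded_atTop a b q hq hgt)
        (eventually_cobounded_not_mem hEfin)
  have hmem : (0 : ℝ) ∈ psi a b q '' Eᶜ :=
    hconn.intermediate_value hwnE hwpE hcont ⟨hneg.le, hpos.le⟩
  obtain ⟨w, hwE, hw0⟩ := hmem
  have hgood := hEgood w hwE
  exact hwE (Or.inr ⟨hgood.1, hgood.2, hw0⟩)

end LevelSet

end Summit.Schanuel.Schanuel.Theorems
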